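import Literature.NumberTheory.LFunctions.KMVWeilRangeOffDiagonal
import Literature.NumberTheory.LFunctions.KMVDiagonalSlack
import Literature.NumberTheory.LFunctions.KMVMollifierDiagonalMainTerm
import Literature.NumberTheory.LFunctions.Bettin2017PrimeLevelHolds
import Summits.Parity.GeneralizedHardyLittlewood.Theorems.BeyondDiagonalBeatsQuarter.PeterssonSplit
import Summits.Parity.GeneralizedHardyLittlewood.Theorems.BeyondDiagonalBeatsQuarter.CornerNegligibleXSq
import Summits.Parity.GeneralizedHardyLittlewood.Theorems.BeyondDiagonalBeatsQuarter.KernelFormXSq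
import HarnessLib

/-!
# Route `PrimeLevelFamEdge` — the PRINTED range of the KMV moment asymptotics, Weil half, ASSEMBLED:
# **both KMV displays at `(P, Q) = (X², 1)` hold unconditionally for mollifier length `M = q̂^Δ`,
# `0 < Δ < 1/2`** (unit `littype-ls-input-kmvdiag`, [INPUT KMV2000.MomentAsymptotics]; helper)

`KMV2000.MomentAsymptotics Δlo Δhi T₁ T₂` (`KMVMomentAsymptoticsBeyondDiagonal`) is the printed SHAPE of
Kowalski–Michel–VanderKam's mollified first/second harmonic moments at prime level; its printed-range
instance (`momentAsymptoticsDiagOnly_of_kmv`, windows `⊆ (0,1)`, `T₁ = T₂ = 0`) is conditional on the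
named facts `kmv2000_firstMomentPQ` / `kmv2000_secondMomentPQ` (all admissible `P`, all even-or-odd `Q`).
Every consumer in the tree uses the predicate ONCE, at `Q = 1` for one profile
(`KMV2000.goodMass_lower_of_displaysAtOne`, hypothesis `hH`). This file proves that hypothesis `hH`
UNCONDITIONALLY for the profile `P = X²` on the Weil half `0 < Δ < 1/2` of the printed range
(`displaysAtOne_X_sq_weilRange`), from tree theorems only:
* first display (any admissible `P`, `0 < Δ < 2`): `KMV2000.firstDisplay_of_bettin'` with
  `bettin2017_theorem11_primeLevel_holds` (Bettin 2017 Thm 1.1 at prime level, proved from Petersson);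
* second display at `(X², 1)`, `0 < Δ < 1/2` (`secondDisplay_X_sq_one_weilRange`): the exact Petersson/AFE
  split `PeterssonSplit.QhPQ_X_sq_one_split` (H4), the q-free kernel asymptotics
  `KernelFormXSq.kernelForm_xsq_asymp` (stub N, extended here from `L ≤ log M` to every `L ≥ 0` by
  affinity in `L`, `kernelForm_xsq_asymp_allL`), the corner bound `Corner.abs_corner_le` (H1), and the
  Weil-range off-diagonal bound `KMV2000.WeilOffDiag.norm_mollified_offDiag_le`
  (`Literature/…/KMVWeilRangeOffDiagonal`, KMV p. 13 «if one uses the Weil bound … only in the range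
  Δ < 1/2»), with `secondMomentForm Δ X² 1 = 4 + 4/Δ` and `ζ(2) = π²/6`.
What this is NOT: nothing for `1/2 ≤ Δ < 1` (needs KMV Lemma 3.3 = [VdK2]/[I-S], the named fact
`kmv2000_lemma33_dyadic`), nothing for general `(P, Q)` (needs the all-order AFE with two derivative
orders and the general residue evaluation (26)–(28)/p. 19), nothing beyond the diagonal (K_B), no
Landau–Siegel claim. Helper (`--supports stmt-Parity-20343 --as helper`); theorems only; standard axioms.
«The programme SEARCHES and TYPES; no claim about Landau–Siegel zeros, Theorems 1–2 of
arXiv:2211.02515 or a repaired Margin232 until a kernel theorem says so.»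
-/

noncomputable section

open Finset Polynomial
open scoped Real

namespace Summit.Parity.GeneralizedHardyLittlewood.Theorems.BeyondDiagonalBeatsQuarter.WeilRange

open Literature.NumberTheory.LFunctions Literature.NumberTheory.LFunctions.KMV2000
open KernelFormXSq (xsq)
open Corner (trueDiagKernel)

/-! ### The kernel form is affine in the level parameter `L` -/

/-- `kmvKernel L a b = kmvKernel 0 a b + L·(Σ_{c∣(a,b)} c·τ((a/c)(b/c)))/(ab)`: the continued KMV kernel is
affine in `L = log q̂`. [cite: KowalskiMichelVanderKam2000, (21)–(23) pp. 12–13 — derivation] -/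
theorem kmvKernel_affine (L : ℝ) (a b : ℕ) :
    kmvKernel L a b = kmvKernel 0 a b +
      L * ((∑ c ∈ (Nat.gcd a b).divisors, (c : ℝ) * ((a / c * (b / c)).divisors.card : ℝ)) /
        ((a : ℝ) * b)) := by
  unfold kmvKernel
  rw [mul_div_assoc', ← add_div]
  congr 1
  rw [Finset.mul_sum, ← Finset.sum_add_distrib]
  refine Finset.sum_congr rfl fun c _ ↦ ?_
  ring

/-- **Stub N for every level parameter `L ≥ 0`.** The q-free `X²` kernel asymptotics
`|Σ_{a,b ≤ M} x_a x_b K_L(a,b) − 4ζ(2)²(L/log M + 1)/log²M| ≤ C(1 + 2L/log M)/log³M` for `M ≥ M₀ (≥ 3)` and ALL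
`L ≥ 0` (the tree's `kernelForm_xsq_asymp` has `L ≤ log M`; both sides are affine in `L`, so the two
endpoint bounds `L = 0`, `L = log M` extrapolate). For `M = q̂^Δ`, `L = log q̂` this is `L/log M = 1/Δ`.
[cite: KowalskiMichelVanderKam2000, Prop. 5.1 (31) p. 18 — derivation (P = X², all L)] -/
theorem kernelForm_xsq_asymp_allL :
    ∃ C M₀ : ℝ, 0 ≤ C ∧ 3 ≤ M₀ ∧ ∀ M : ℝ, M₀ ≤ M → ∀ L : ℝ, 0 ≤ L →
      |∑ a ∈ Icc 1 ⌊M⌋₊, ∑ b ∈ Icc 1 ⌊M⌋₊, xsq M a * xsq M b * kmvKernel L a b -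
          4 * (π ^ 2 / 6) ^ 2 * (L / Real.log M + 1) / Real.log M ^ 2| ≤
        C * (1 + 2 * L / Real.log M) / Real.log M ^ 3 := by
  obtain ⟨C, M₀, h⟩ := KernelFormXSq.kernelForm_xsq_asymp
  refine ⟨max C 0, max M₀ 3, le_max_right _ _, le_max_right _ _, fun M hM L hL ↦ ?_⟩
  have hM₀ : M₀ ≤ M := (le_max_left _ _).trans hM
  have hM3 : 3 ≤ M := (le_max_right _ _).trans hM
  have hℓ1 : 1 ≤ Real.log M := by
    rw [Real.le_log_iff_exp_le (by linarith)]
    have := Real.exp_one_lt_d9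
    linarith
  have hℓ0 : 0 < Real.log M := by linarith
  -- the slope of the kernel form in `L`
  obtain ⟨B, hB⟩ : ∃ B : ℝ, B = ∑ a ∈ Icc 1 ⌊M⌋₊, ∑ b ∈ Icc 1 ⌊M⌋₊, xsq M a * xsq M b *
      ((∑ c ∈ (Nat.gcd a b).divisors, (c : ℝ) * ((a / c * (b / c)).divisors.card : ℝ)) /
        ((a : ℝ) * b)) := ⟨_, rfl⟩
  have hFaff : ∀ L' : ℝ, ∑ a ∈ Icc 1 ⌊M⌋₊, ∑ b ∈ Icc 1 ⌊M⌋₊, xsq M a * xsq M b * kmvKernel L' a b =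
      ∑ a ∈ Icc 1 ⌊M⌋₊, ∑ b ∈ Icc 1 ⌊M⌋₊, xsq M a * xsq M b * kmvKernel 0 a b + L' * B := by
    intro L'
    rw [hB, Finset.mul_sum, ← Finset.sum_add_distrib]
    refine Finset.sum_congr rfl fun a _ ↦ ?_
    rw [Finset.mul_sum, ← Finset.sum_add_distrib]
    refine Finset.sum_congr rfl fun b _ ↦ ?_
    rw [kmvKernel_affine L' a b]
    ring
  -- the two endpoint bounds
  have h0 := h M hM₀ 0 le_rfl hℓ0.le
  have h1 := h M hM₀ (Real.log M) hℓ0.le le_rfl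
  rw [hFaff 0] at h0
  rw [hFaff (Real.log M)] at h1
  rw [hFaff L]
  -- abbreviate
  set F0 : ℝ := ∑ a ∈ Icc 1 ⌊M⌋₊, ∑ b ∈ Icc 1 ⌊M⌋₊, xsq M a * xsq M b * kmvKernel 0 a b with hF0
  set ℓ : ℝ := Real.log M with hℓ
  set Z : ℝ := 4 * (π ^ 2 / 6) ^ 2 with hZ
  -- G(L) = G(0) + (L/ℓ)(G(ℓ) − G(0))
  have hG : F0 + L * B - Z * (L / ℓ + 1) / ℓ ^ 2 =
      (F0 + 0 * B - Z * (0 / ℓ + 1) / ℓ ^ 2) +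
        (L / ℓ) * ((F0 + ℓ * B - Z * (ℓ / ℓ + 1) / ℓ ^ 2) - (F0 + 0 * B - Z * (0 / ℓ + 1) / ℓ ^ 2)) := by
    field_simp
    ring
  rw [hG]
  have hLℓ : 0 ≤ L / ℓ := div_nonneg hL hℓ0.le
  have hC0 : C ≤ max C 0 := le_max_left _ _
  calc |(F0 + 0 * B - Z * (0 / ℓ + 1) / ℓ ^ 2) +
        (L / ℓ) * ((F0 + ℓ * B - Z * (ℓ / ℓ + 1) / ℓ ^ 2) - (F0 + 0 * B - Z * (0 / ℓ + 1) / ℓ ^ 2))|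
      ≤ |F0 + 0 * B - Z * (0 / ℓ + 1) / ℓ ^ 2| +
        |(L / ℓ) * ((F0 + ℓ * B - Z * (ℓ / ℓ + 1) / ℓ ^ 2) - (F0 + 0 * B - Z * (0 / ℓ + 1) / ℓ ^ 2))| :=
        abs_add_le _ _
    _ = |F0 + 0 * B - Z * (0 / ℓ + 1) / ℓ ^ 2| +
        (L / ℓ) * |(F0 + ℓ * B - Z * (ℓ / ℓ + 1) / ℓ ^ 2) - (F0 + 0 * B - Z * (0 / ℓ + 1) / ℓ ^ 2)| := by
        rw [abs_mul, abs_of_nonneg hLℓ]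
    _ ≤ |F0 + 0 * B - Z * (0 / ℓ + 1) / ℓ ^ 2| +
        (L / ℓ) * (|F0 + ℓ * B - Z * (ℓ / ℓ + 1) / ℓ ^ 2| + |F0 + 0 * B - Z * (0 / ℓ + 1) / ℓ ^ 2|) := by
        gcongr
        exact abs_sub _ _
    _ ≤ C / ℓ ^ 3 + (L / ℓ) * (C / ℓ ^ 3 + C / ℓ ^ 3) := by
        gcongr
    _ = C * (1 + 2 * L / ℓ) / ℓ ^ 3 := by
        field_simp
        ring
    _ ≤ max C 0 * (1 + 2 * L / ℓ) / ℓ ^ 3 := by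
        have : 0 ≤ (1 + 2 * L / ℓ) / ℓ ^ 3 := by positivity
        calc C * (1 + 2 * L / ℓ) / ℓ ^ 3 = C * ((1 + 2 * L / ℓ) / ℓ ^ 3) := by ring
          _ ≤ max C 0 * ((1 + 2 * L / ℓ) / ℓ ^ 3) := mul_le_mul_of_nonneg_right hC0 this
          _ = max C 0 * (1 + 2 * L / ℓ) / ℓ ^ 3 := by ring

/-! ### The second display at `(X², 1)` on the Weil range -/

/-- `T ≤ q̂` as soon as `(2πT)² ≤ q` (`T ≥ 0`). [folklore] -/
theorem le_qhat_of_sq_le {T : ℝ} (hT : 0 ≤ T) {q : ℕ} (hq : (2 * π * T) ^ 2 ≤ (q : ℝ)) : T ≤ qhat q := by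
  have h2π : 0 < 2 * π := by positivity
  have hsq : 2 * π * T ≤ Real.sqrt q := by
    rw [show 2 * π * T = Real.sqrt ((2 * π * T) ^ 2) by rw [Real.sqrt_sq (by positivity)]]
    exact Real.sqrt_le_sqrt hq
  unfold qhat
  rw [le_div_iff₀ h2π]
  linarith

/-- **The second KMV display at `(P, Q) = (X², 1)` on the Weil range `0 < Δ < 1/2`, UNCONDITIONAL.**
For `0 < Δ < 1/2` there are `C, q₀` with, for every prime `q ≥ q₀`,
`‖Q^h(X², 1; q̂^Δ) − 2ζ(2)²·q̂/(Δ² log² q̂)·(secondMomentForm Δ X² 1 + 0)‖ ≤ C·q̂·(log q̂)^{−3}`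
— KMV's second display of §6 p. 19 (= Prop. 5.1 (31) at `k = 0`) in the typed shape of
`kmv2000_secondMomentPQ` / `KMV2000.MomentAsymptotics` (extra main term `t₂ = 0`), on the half of the
printed range that the Weil bound delivers. [cite: KowalskiMichelVanderKam2000, §6 p. 19 (second display) / Prop. 5.1 (31) p. 18 and §5 p. 13 («only in the range Δ < 1/2»)] -/
theorem secondDisplay_X_sq_one_weilRange {Δ : ℝ} (hΔ0 : 0 < Δ) (hΔ : Δ < 1 / 2) :
    ∃ C : ℝ, ∃ q₀ : ℕ, ∀ (q : ℕ) [NeZero q], q.Prime → q₀ ≤ q →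
      ‖QhPQ q (X ^ 2) 1 (qhat q ^ Δ) -
          ((2 * riemannZeta 2 ^ 2 * ((qhat q / (Δ ^ 2 * Real.log (qhat q) ^ 2) : ℝ) : ℂ)) *
            ((KMV2000.secondMomentForm Δ (X ^ 2) 1 + 0 : ℝ) : ℂ))‖ ≤
        C * qhat q * (Real.log (qhat q))⁻¹ ^ 3 := by
  obtain ⟨C₁, q₁, hOFF⟩ := WeilOffDiag.norm_mollified_offDiag_le hΔ0 hΔ
  obtain ⟨C₂, M₀, hC₂, hM₀, hN⟩ := kernelForm_xsq_asymp_allL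
  obtain ⟨C₃, hC₃, hH1⟩ := Corner.abs_corner_le (κ := 1) one_pos
  -- threshold: q ≥ q₁, q ≥ 400 (q̂ ≥ 3) and q̂ ≥ T := M₀^{1/Δ} (so that M = q̂^Δ ≥ M₀)
  have hM₀0 : 0 < M₀ := by linarith
  set T : ℝ := M₀ ^ (1 / Δ) with hT
  have hT0 : 0 ≤ T := Real.rpow_nonneg hM₀0.le _
  refine ⟨C₁ + 2 * (C₃ + C₂ * (1 + 2 / Δ)) / Δ ^ 3,
    max q₁ (max 400 ⌈(2 * π * T) ^ 2⌉₊), fun q _ hq hq₀ ↦ ?_⟩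
  have hq₁ : q₁ ≤ q := (le_max_left _ _).trans hq₀
  have hq400 : 400 ≤ q := (le_max_left _ _).trans ((le_max_right _ _).trans hq₀)
  have hqT : ⌈(2 * π * T) ^ 2⌉₊ ≤ q := (le_max_right _ _).trans ((le_max_right _ _).trans hq₀)
  have hQ3 : 3 ≤ qhat q := WeilOffDiag.three_le_qhat hq400
  have hQ1 : 1 ≤ qhat q := by linarith
  have hQ0 : 0 < qhat q := by linarith
  have hq0 : (0 : ℝ) < q := by exact_mod_cast hq.pos
  have hTQ : T ≤ qhat q := le_qhat_of_sq_le hT0 ((Nat.le_ceil _).trans (by exact_mod_cast hqT))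
  -- the length `M = q̂^Δ`
  set M : ℝ := qhat q ^ Δ with hMdef
  have hMM₀ : M₀ ≤ M := by
    have h : T ^ Δ ≤ qhat q ^ Δ := Real.rpow_le_rpow hT0 hTQ hΔ0.le
    have hTΔ : T ^ Δ = M₀ := by
      rw [hT, ← Real.rpow_mul hM₀0.le, one_div_mul_cancel hΔ0.ne', Real.rpow_one]
    rw [hMdef, ← hTΔ]; exact h
  have hM3 : 3 ≤ M := hM₀.trans hMM₀
  have hM2 : 2 ≤ M := by linarith
  have hM1 : 1 ≤ M := by linarith
  have hMQ : M ≤ qhat q := by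
    calc M = qhat q ^ Δ := rfl
      _ ≤ qhat q ^ (1 : ℝ) := Real.rpow_le_rpow_of_exponent_le hQ1 (by linarith)
      _ = qhat q := Real.rpow_one _
  have hMQ' : M ≤ qhat q ^ ((2 : ℝ) - 1) := by norm_num; exact hMQ
  have hQsq : qhat q ^ 2 ≤ q := by
    unfold qhat
    rw [div_pow, Real.sq_sqrt hq0.le]
    exact div_le_self hq0.le (by nlinarith [Real.pi_gt_three])
  have hMq : M < q := by
    have : qhat q < qhat q ^ 2 := by nlinarith
    linarith
  -- logarithms: ℓ = log M = Δ L
  set L : ℝ := Real.log (qhat q) with hLdef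
  have hL1 : 1 ≤ L := by
    rw [hLdef, Real.le_log_iff_exp_le hQ0]
    have := Real.exp_one_lt_d9
    linarith
  have hL0 : 0 < L := by linarith
  have hℓ : Real.log M = Δ * L := by rw [hMdef, Real.log_rpow hQ0]
  have hℓ0 : 0 < Real.log M := by rw [hℓ]; positivity
  -- the four inputs
  have hsplit := PeterssonSplit.QhPQ_X_sq_one_split hq hM1 hMq
  have hN' := hN M hMM₀ L hL0.le
  have hH1' := hH1 (qhat q) M (by linarith) hM2 hMQ'
  have hOFF' := hOFF q hq hq₁
  -- the diagonal: true kernel = continued kernel + corner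
  have hdiag : ∑ l ∈ Icc 1 ⌊M⌋₊, ∑ m ∈ Icc 1 ⌊M⌋₊, xsq M l * xsq M m * trueDiagKernel (qhat q) l m =
      ∑ l ∈ Icc 1 ⌊M⌋₊, ∑ m ∈ Icc 1 ⌊M⌋₊, xsq M l * xsq M m * kmvKernel (Real.log (qhat q)) l m +
      ∑ l ∈ Icc 1 ⌊M⌋₊, ∑ m ∈ Icc 1 ⌊M⌋₊, xsq M l * xsq M m *
        (trueDiagKernel (qhat q) l m - kmvKernel (Real.log (qhat q)) l m) := by
    rw [← Finset.sum_add_distrib]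
    refine Finset.sum_congr rfl fun l _ ↦ ?_
    rw [← Finset.sum_add_distrib]
    refine Finset.sum_congr rfl fun m _ ↦ ?_
    ring
  -- the main term as a real number
  have hMT : (2 * riemannZeta 2 ^ 2 * ((qhat q / (Δ ^ 2 * Real.log (qhat q) ^ 2) : ℝ) : ℂ)) *
      ((KMV2000.secondMomentForm Δ (X ^ 2) 1 + 0 : ℝ) : ℂ) =
      ((2 * qhat q * (4 * (π ^ 2 / 6) ^ 2 * (L / Real.log M + 1) / Real.log M ^ 2) : ℝ) : ℂ) := by
    have hLc : (L : ℂ) ≠ 0 := by exact_mod_cast hL0.ne'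
    have hΔc : (Δ : ℂ) ≠ 0 := by exact_mod_cast hΔ0.ne'
    rw [riemannZeta_two, secondMomentForm_X_sq_one, hℓ, ← hLdef]
    push_cast
    field_simp
    ring
  -- assemble: QhPQ − MT = 2q̂·(K − main) + 2q̂·corner − OFF
  rw [hMT, hsplit, hdiag]
  set K : ℝ := ∑ l ∈ Icc 1 ⌊M⌋₊, ∑ m ∈ Icc 1 ⌊M⌋₊, xsq M l * xsq M m * kmvKernel (Real.log (qhat q)) l m
    with hK
  set Co : ℝ := ∑ l ∈ Icc 1 ⌊M⌋₊, ∑ m ∈ Icc 1 ⌊M⌋₊, xsq M l * xsq M m *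
    (trueDiagKernel (qhat q) l m - kmvKernel (Real.log (qhat q)) l m) with hCo
  set mainK : ℝ := 4 * (π ^ 2 / 6) ^ 2 * (L / Real.log M + 1) / Real.log M ^ 2 with hmainK
  set OFFs : ℂ := ∑ l ∈ Icc 1 ⌊M⌋₊, ∑ m ∈ Icc 1 ⌊M⌋₊,
    ((mollifierCoeff (X ^ 2) M l * mollifierCoeff (X ^ 2) M m : ℝ) : ℂ) * PeterssonSplit.offDiag q l m
    with hOFFs
  have hOFFs' : ‖OFFs‖ ≤ C₁ * qhat q * L⁻¹ ^ 3 := hOFF'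
  have hKm : |K - mainK| ≤ C₂ * (1 + 2 * L / Real.log M) / Real.log M ^ 3 := hN'
  have hCo' : |Co| ≤ C₃ / Real.log M ^ 3 := hH1'
  have hrew : (((2 * qhat q * (K + Co) : ℝ)) : ℂ) - OFFs - ((2 * qhat q * mainK : ℝ) : ℂ) =
      ((2 * qhat q * ((K - mainK) + Co) : ℝ) : ℂ) - OFFs := by
    push_cast; ring
  rw [hrew]
  -- numerical bookkeeping: 1/log³M = 1/(Δ³L³), (1 + 2L/ℓ) = 1 + 2/Δ
  have hℓ3 : Real.log M ^ 3 = Δ ^ 3 * L ^ 3 := by rw [hℓ]; ring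
  have hratio : 1 + 2 * L / Real.log M = 1 + 2 / Δ := by
    rw [hℓ]; field_simp
  rw [hratio] at hKm
  have hLinv : L⁻¹ ^ 3 = 1 / L ^ 3 := by rw [inv_pow, one_div]
  calc ‖((2 * qhat q * ((K - mainK) + Co) : ℝ) : ℂ) - OFFs‖
      ≤ ‖((2 * qhat q * ((K - mainK) + Co) : ℝ) : ℂ)‖ + ‖OFFs‖ := norm_sub_le _ _
    _ = 2 * qhat q * |(K - mainK) + Co| + ‖OFFs‖ := by
        rw [Complex.norm_real, Real.norm_eq_abs, abs_mul, abs_of_pos (by positivity : 0 < 2 * qhat q)]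
    _ ≤ 2 * qhat q * (|K - mainK| + |Co|) + ‖OFFs‖ := by
        gcongr; exact abs_add_le _ _
    _ ≤ 2 * qhat q * (C₂ * (1 + 2 / Δ) / Real.log M ^ 3 + C₃ / Real.log M ^ 3) +
        C₁ * qhat q * L⁻¹ ^ 3 := by gcongr
    _ = (C₁ + 2 * (C₃ + C₂ * (1 + 2 / Δ)) / Δ ^ 3) * qhat q * L⁻¹ ^ 3 := by
        rw [hℓ3, hLinv]
        field_simp
        ring

/-- **Both KMV displays at `(X², 1)`, mollifier length `q̂^Δ`, `0 < Δ < 1/2` — UNCONDITIONAL**, in exactly the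
shape of hypothesis `hH` of `KMV2000.goodMass_lower_of_displaysAtOne` (`t₁ = t₂ = 0`; the genericity side
condition `q̂^Δ ∉ ℕ` is not even needed). The first display is Bettin's prime-level first moment + the
mollifier main term (`KMV2000.firstDisplay_of_bettin'`, `bettin2017_theorem11_primeLevel_holds`, valid for
`0 < Δ < 2`); the second is `secondDisplay_X_sq_one_weilRange`. This is the Weil half of the printed-range
instance of `KMV2000.MomentAsymptotics` in the pointwise currency every consumer uses.
[cite: KowalskiMichelVanderKam2000, §6 p. 19 (the two displays), Props. 4.1 (30) / 5.1 (31), §5 p. 13 (range Δ < 1/2 with Weil's bound)] -/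
theorem displaysAtOne_X_sq_weilRange {Δ : ℝ} (hΔ0 : 0 < Δ) (hΔ : Δ < 1 / 2) :
    ∃ C : ℝ, ∃ q₀ : ℕ, ∀ (q : ℕ) [NeZero q], q.Prime → q₀ ≤ q →
      (∀ n : ℕ, (n : ℝ) ≠ qhat q ^ Δ) →
        ‖LhPQ q (X ^ 2) 1 (qhat q ^ Δ) -
            ((riemannZeta 2 * ((Real.sqrt (qhat q) / (Δ * Real.log (qhat q)) : ℝ) : ℂ)) *
              ((KMV2000.linForm Δ (X ^ 2) 1 + 0 : ℝ) : ℂ))‖ ≤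
          C * Real.sqrt (qhat q) * (Real.log (qhat q))⁻¹ ^ 2 ∧
        ‖QhPQ q (X ^ 2) 1 (qhat q ^ Δ) -
            ((2 * riemannZeta 2 ^ 2 * ((qhat q / (Δ ^ 2 * Real.log (qhat q) ^ 2) : ℝ) : ℂ)) *
              ((KMV2000.secondMomentForm Δ (X ^ 2) 1 + 0 : ℝ) : ℂ))‖ ≤
          C * qhat q * (Real.log (qhat q))⁻¹ ^ 3 := by
  obtain ⟨C₁, q₁, h₁⟩ := KMV2000.firstDisplay_of_bettin' bettin2017_theorem11_primeLevel_holds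
    admissible_X_sq hΔ0 (by linarith : Δ < 2)
  obtain ⟨C₂, q₂, h₂⟩ := secondDisplay_X_sq_one_weilRange hΔ0 hΔ
  refine ⟨max C₁ C₂, max q₁ (max q₂ 40), fun q _ hq hq₀ _ ↦ ⟨?_, ?_⟩⟩
  · have h := h₁ q hq ((le_max_left _ _).trans hq₀)
    exact h.trans (mul_le_mul_of_nonneg_right
      (mul_le_mul_of_nonneg_right (le_max_left _ _) (Real.sqrt_nonneg _)) (sq_nonneg _))
  · have h := h₂ q hq ((le_max_left _ _).trans ((le_max_right _ _).trans hq₀))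
    have hq40 : 40 ≤ q := (le_max_right _ _).trans ((le_max_right _ _).trans hq₀)
    have hlog : 0 ≤ (Real.log (qhat q))⁻¹ := inv_nonneg.mpr (Real.log_nonneg (one_lt_qhat hq40).le)
    have hQ : 0 ≤ qhat q := (qhat_pos (by omega)).le
    exact h.trans (mul_le_mul_of_nonneg_right
      (mul_le_mul_of_nonneg_right (le_max_right _ _) hQ) (pow_nonneg hlog 3))

end Summit.Parity.GeneralizedHardyLittlewood.Theorems.BeyondDiagonalBeatsQuarter.WeilRange
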